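import Summits.ValiantsHypothesis.ValiantsHypothesis.Theorems.LacunarySymmetroidMatrixDescartesCensusGardingLorentz

/-!
# `MatrixDescartes` census — Gårding dictionary at `(3,4)`, part 4: the Gram-sign rows G3 / G4

HONEST FRAMING.  Companion of `…CensusGardingRows/Dictionary/Lorentz.lean` (object-search cell `pub-symmetroid`; beside the OPEN typed
statement `DoorA34 = PosRootLawAt 3 4 18`, stmt-ValiantsHypothesis-19980).  Engine-2's LP34 rows G3/G4 (`LP34-CERT.md` §2): for a positive
definite letter `P`, the Gram matrix of `(P, X, Y)` (resp. `(P, X, Y, Z)`) under the Lorentzian form `b_P` (polarisation of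
`q_P(X) = tr(adj X · P) = 3 D(P,X,X)`; signature `(1,5)` on `Sym₃`) has signature `≤ (1,2)` (resp. `≤ (1,3)`), hence determinant `≥ 0`
(resp. `≤ 0`).  Kernel route at `P = 1`: `q_1(X) = ½((tr X)² − ‖X‖²)`, `b_1(X,Y) = ½(tr X tr Y − ⟨X,Y⟩)` (`trace_adjugate_eq_half`,
`polar_trace_adjugate_eq_half`), so after splitting off the trace part the Gram determinants are `¾ (‖X₀‖²‖Y₀‖² − ⟨X₀,Y₀⟩²) ≥ 0`
(Cauchy–Schwarz, `Finset.sum_mul_sq_le_sq_mul_sq`); a general `P = M Mᵀ ≻ 0` reduces to `P = 1` by `Census.trace_adjugate_congr` (every Gram entry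
scales by `(det M)²`).  G4 uses the same mechanism one dimension up: `16 ×` the Gram determinant of `(1,X,Y,Z)` equals `−6 · det Gram_F(X₀,Y₀,Z₀)`, a Euclidean
Gram determinant (`Matrix.posSemidef_self_mul_conjTranspose`, `PosSemidef.det_nonneg`).  Rows for a DEFINITE letter only; nothing on the
all-indefinite residue of `DoorA34`, on `ζ_sym(3,4)`, on `MatrixDescartes` (stmt-ValiantsHypothesis-18050) or `VP ≠ VNP`.

[folklore] Lorentzian Gram determinants; elementary.
-/

-- `Summit.ValiantsHypothesis.ValiantsHypothesis.…` repeats a component by the D-0017 layout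
-- (single-conjunct summit), which the `dupNamespace` linter flags; the name is mandated.
set_option linter.dupNamespace false

namespace Summit.ValiantsHypothesis.ValiantsHypothesis.Theorems.LacunarySymmetroidMatrixDescartes.Census

open Polynomial Matrix Finset
open scoped BigOperators Polynomial Matrix

/-- `tr(adj X) = ½((tr X)² − Σᵢⱼ Xᵢⱼ Xⱼᵢ)` for `3 × 3` matrices. [folklore] -/
theorem trace_adjugate_eq_half (X : Matrix (Fin 3) (Fin 3) ℝ) :
    X.adjugate.trace = ((X.trace) ^ 2 - ∑ i, ∑ j, X i j * X j i) / 2 := by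
  rw [trace_adjugate_fin_three, Matrix.trace_fin_three]
  simp only [Fin.sum_univ_three]
  ring

/-- Polarisation of `tr ∘ adj` (`3 × 3`): `tr(adj(X+Y)) − tr(adj X) − tr(adj Y) = tr X · tr Y − Σᵢⱼ Xᵢⱼ Yⱼᵢ`. [folklore] -/
theorem polar_trace_adjugate_eq (X Y : Matrix (Fin 3) (Fin 3) ℝ) :
    (X + Y).adjugate.trace - X.adjugate.trace - Y.adjugate.trace = X.trace * Y.trace - ∑ i, ∑ j, X i j * Y j i := by
  rw [trace_adjugate_fin_three, trace_adjugate_fin_three, trace_adjugate_fin_three, Matrix.trace_fin_three, Matrix.trace_fin_three]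
  simp only [Fin.sum_univ_three, Matrix.add_apply]
  ring

/-- `b_1(1, X) = tr X`: `tr(adj(1+X)) − tr(adj 1) − tr(adj X) = 2 tr X` (`3 × 3`). [folklore] -/
theorem polar_trace_adjugate_one (X : Matrix (Fin 3) (Fin 3) ℝ) :
    ((1 : Matrix (Fin 3) (Fin 3) ℝ) + X).adjugate.trace - (1 : Matrix (Fin 3) (Fin 3) ℝ).adjugate.trace - X.adjugate.trace
      = 2 * X.trace := by
  rw [polar_trace_adjugate_eq, Matrix.trace_one, Matrix.trace_fin_three, Fintype.card_fin]
  simp only [Fin.sum_univ_three, Matrix.one_apply_eq, Matrix.one_apply_ne (by decide : (0 : Fin 3) ≠ 1),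
    Matrix.one_apply_ne (by decide : (0 : Fin 3) ≠ 2), Matrix.one_apply_ne (by decide : (1 : Fin 3) ≠ 0),
    Matrix.one_apply_ne (by decide : (1 : Fin 3) ≠ 2), Matrix.one_apply_ne (by decide : (2 : Fin 3) ≠ 0),
    Matrix.one_apply_ne (by decide : (2 : Fin 3) ≠ 1)]
  push_cast
  ring

/-- `tr(adj 1) = 3` (`3 × 3`). [folklore] -/
theorem trace_adjugate_one_three : (1 : Matrix (Fin 3) (Fin 3) ℝ).adjugate.trace = 3 := by
  rw [Matrix.adjugate_one, Matrix.trace_one, Fintype.card_fin]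
  norm_num

/-- **G3 at `P = 1`** — the Gram determinant of `(1, X, Y)` under `b_1` is nonnegative: with `q = tr ∘ adj`, `β(X,Y) = tr(adj(X+Y)) − q X − q Y`
(`= 2 b_1`), `det [[3, tr X, tr Y], [tr X, q X, β/2], [tr Y, β/2, q Y]] ≥ 0`, written multiplied out (`× 4`).  It equals
`¾ (‖X₀‖² ‖Y₀‖² − ⟨X₀, Y₀⟩²)` for the trace-free parts — Cauchy–Schwarz. [folklore] -/
theorem gram_three_nonneg_one {X Y : Matrix (Fin 3) (Fin 3) ℝ} (hX : X.IsSymm) (hY : Y.IsSymm) :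
    0 ≤ 4 * (3 * (X.adjugate.trace * Y.adjugate.trace) - X.trace ^ 2 * Y.adjugate.trace - Y.trace ^ 2 * X.adjugate.trace)
      + 4 * (X.trace * Y.trace) * ((X + Y).adjugate.trace - X.adjugate.trace - Y.adjugate.trace)
      - 3 * ((X + Y).adjugate.trace - X.adjugate.trace - Y.adjugate.trace) ^ 2 := by
  -- trace-free parts
  set X₀ : Matrix (Fin 3) (Fin 3) ℝ := X - (X.trace / 3) • (1 : Matrix (Fin 3) (Fin 3) ℝ) with hX₀
  set Y₀ : Matrix (Fin 3) (Fin 3) ℝ := Y - (Y.trace / 3) • (1 : Matrix (Fin 3) (Fin 3) ℝ) with hY₀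
  have h10 : X 1 0 = X 0 1 := by simpa using hX.apply 0 1
  have h20 : X 2 0 = X 0 2 := by simpa using hX.apply 0 2
  have h21 : X 2 1 = X 1 2 := by simpa using hX.apply 1 2
  have k10 : Y 1 0 = Y 0 1 := by simpa using hY.apply 0 1
  have k20 : Y 2 0 = Y 0 2 := by simpa using hY.apply 0 2
  have k21 : Y 2 1 = Y 1 2 := by simpa using hY.apply 1 2
  -- the Gram determinant is `3 ×` the Cauchy–Schwarz defect of the trace-free parts (Frobenius pairing)
  have ident : 4 * (3 * (X.adjugate.trace * Y.adjugate.trace) - X.trace ^ 2 * Y.adjugate.trace - Y.trace ^ 2 * X.adjugate.trace)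
      + 4 * (X.trace * Y.trace) * ((X + Y).adjugate.trace - X.adjugate.trace - Y.adjugate.trace)
      - 3 * ((X + Y).adjugate.trace - X.adjugate.trace - Y.adjugate.trace) ^ 2
      = 3 * ((∑ p : Fin 3 × Fin 3, X₀ p.1 p.2 ^ 2) * (∑ p : Fin 3 × Fin 3, Y₀ p.1 p.2 ^ 2)
          - (∑ p : Fin 3 × Fin 3, X₀ p.1 p.2 * Y₀ p.1 p.2) ^ 2) := by
    rw [trace_adjugate_fin_three X, trace_adjugate_fin_three Y, trace_adjugate_fin_three (X + Y), Matrix.trace_fin_three,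
      Matrix.trace_fin_three]
    simp only [Matrix.add_apply, Fintype.sum_prod_type, Fin.sum_univ_three, hX₀, hY₀, Matrix.sub_apply, Matrix.smul_apply,
      Matrix.one_apply_eq, Matrix.one_apply_ne (by decide : (0 : Fin 3) ≠ 1), Matrix.one_apply_ne (by decide : (0 : Fin 3) ≠ 2),
      Matrix.one_apply_ne (by decide : (1 : Fin 3) ≠ 0), Matrix.one_apply_ne (by decide : (1 : Fin 3) ≠ 2),
      Matrix.one_apply_ne (by decide : (2 : Fin 3) ≠ 0), Matrix.one_apply_ne (by decide : (2 : Fin 3) ≠ 1),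
      smul_eq_mul, mul_one, mul_zero, sub_zero, Matrix.trace_fin_three, h10, h20, h21, k10, k20, k21]
    ring
  rw [ident]
  have cs := Finset.sum_mul_sq_le_sq_mul_sq (Finset.univ : Finset (Fin 3 × Fin 3)) (fun p => X₀ p.1 p.2) (fun p => Y₀ p.1 p.2)
  beta_reduce at cs
  linarith [cs]

set_option maxHeartbeats 800000 in
/-- **ROW G3 — Gram sign for a positive definite letter** (`3 × 3`): for `P ≻ 0` and symmetric `X, Y`, with `q(Z) := tr(adj Z · P)`
(`= 3 D(P,Z,Z)`), `β(Z,W) := q(Z+W) − q Z − q W` (`= 6 D(P,Z,W)`) and `q P = 3 det P`, `β(P,Z) = 2 tr(adj P · Z)`: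
`0 ≤ 4 (q P · q X · q Y) − (β(P,X))² q Y − (β(P,Y))² q X + β(P,X) β(P,Y) β(X,Y) − q P · β(X,Y)²`
(= `4 ×` the Gram determinant of `(P,X,Y)` under `b_P = β/2`).  [folklore] -/
theorem garding_row_G3 {P X Y : Matrix (Fin 3) (Fin 3) ℝ} (hP : P.PosDef) (hX : X.IsSymm) (hY : Y.IsSymm) :
    0 ≤ 4 * ((P.adjugate * P).trace * (X.adjugate * P).trace * (Y.adjugate * P).trace)
      - (((P + X).adjugate * P).trace - (P.adjugate * P).trace - (X.adjugate * P).trace) ^ 2 * (Y.adjugate * P).trace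
      - (((P + Y).adjugate * P).trace - (P.adjugate * P).trace - (Y.adjugate * P).trace) ^ 2 * (X.adjugate * P).trace
      + (((P + X).adjugate * P).trace - (P.adjugate * P).trace - (X.adjugate * P).trace)
        * (((P + Y).adjugate * P).trace - (P.adjugate * P).trace - (Y.adjugate * P).trace)
        * (((X + Y).adjugate * P).trace - (X.adjugate * P).trace - (Y.adjugate * P).trace)
      - (P.adjugate * P).trace * (((X + Y).adjugate * P).trace - (X.adjugate * P).trace - (Y.adjugate * P).trace) ^ 2 := by
  obtain ⟨M, hM, rfl⟩ := exists_mul_transpose_of_posDef hP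
  have hMu : IsUnit M.det := isUnit_iff_ne_zero.2 hM
  have hMT : IsUnit Mᵀ.det := by rw [det_transpose]; exact hMu
  have pull : ∀ Z : Matrix (Fin 3) (Fin 3) ℝ, Z.IsSymm →
      ∃ Z' : Matrix (Fin 3) (Fin 3) ℝ, Z'.IsSymm ∧ Z = M * Z' * Mᵀ := by
    intro Z hZ
    refine ⟨M⁻¹ * Z * Mᵀ⁻¹, ?_, ?_⟩
    · unfold Matrix.IsSymm
      rw [transpose_mul, transpose_mul, ← transpose_nonsing_inv, transpose_transpose, hZ.eq, transpose_nonsing_inv,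
        Matrix.mul_assoc]
    · calc Z = (M * M⁻¹) * Z * (Mᵀ⁻¹ * Mᵀ) := by
            rw [Matrix.mul_nonsing_inv M hMu, Matrix.nonsing_inv_mul Mᵀ hMT, Matrix.one_mul, Matrix.mul_one]
        _ = M * (M⁻¹ * Z * Mᵀ⁻¹) * Mᵀ := by simp only [Matrix.mul_assoc]
  obtain ⟨X', hX', rfl⟩ := pull X hX
  obtain ⟨Y', hY', rfl⟩ := pull Y hY
  have hsum : ∀ A B : Matrix (Fin 3) (Fin 3) ℝ, M * A * Mᵀ + M * B * Mᵀ = M * (A + B) * Mᵀ := by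
    intro A B; rw [Matrix.mul_add, Matrix.add_mul]
  -- rewrite every Gram entry through the congruence identity
  have e1 : ((M * Mᵀ).adjugate * (M * Mᵀ)).trace = M.det ^ 2 * (1 : Matrix (Fin 3) (Fin 3) ℝ).adjugate.trace := by
    have h := trace_adjugate_congr M 1
    rwa [Matrix.mul_one] at h
  have eP : ∀ W' : Matrix (Fin 3) (Fin 3) ℝ,
      ((M * Mᵀ + M * W' * Mᵀ).adjugate * (M * Mᵀ)).trace = M.det ^ 2 * ((1 : Matrix (Fin 3) (Fin 3) ℝ) + W').adjugate.trace := by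
    intro W'
    have h := trace_adjugate_congr M (1 + W')
    rwa [Matrix.mul_add, Matrix.add_mul, Matrix.mul_one] at h
  have e2 := eP X'
  have e3 := eP Y'
  rw [e1, e2, e3, hsum, trace_adjugate_congr, trace_adjugate_congr, trace_adjugate_congr, trace_adjugate_one_three]
  have b1 := polar_trace_adjugate_one X'
  have b2 := polar_trace_adjugate_one Y'
  rw [trace_adjugate_one_three] at b1 b2
  have g := gram_three_nonneg_one hX' hY'
  have hd : 0 ≤ M.det ^ 2 := sq_nonneg _
  -- the target is `(det M ^ 2)^3 ×` the `P = 1` statement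
  have key : 4 * ((M.det ^ 2 * 3) * (M.det ^ 2 * X'.adjugate.trace) * (M.det ^ 2 * Y'.adjugate.trace))
      - (M.det ^ 2 * ((1 : Matrix (Fin 3) (Fin 3) ℝ) + X').adjugate.trace - M.det ^ 2 * 3 - M.det ^ 2 * X'.adjugate.trace) ^ 2
          * (M.det ^ 2 * Y'.adjugate.trace)
      - (M.det ^ 2 * ((1 : Matrix (Fin 3) (Fin 3) ℝ) + Y').adjugate.trace - M.det ^ 2 * 3 - M.det ^ 2 * Y'.adjugate.trace) ^ 2
          * (M.det ^ 2 * X'.adjugate.trace)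
      + (M.det ^ 2 * ((1 : Matrix (Fin 3) (Fin 3) ℝ) + X').adjugate.trace - M.det ^ 2 * 3 - M.det ^ 2 * X'.adjugate.trace)
        * (M.det ^ 2 * ((1 : Matrix (Fin 3) (Fin 3) ℝ) + Y').adjugate.trace - M.det ^ 2 * 3 - M.det ^ 2 * Y'.adjugate.trace)
        * (M.det ^ 2 * (X' + Y').adjugate.trace - M.det ^ 2 * X'.adjugate.trace - M.det ^ 2 * Y'.adjugate.trace)
      - (M.det ^ 2 * 3) * (M.det ^ 2 * (X' + Y').adjugate.trace - M.det ^ 2 * X'.adjugate.trace - M.det ^ 2 * Y'.adjugate.trace) ^ 2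
      = (M.det ^ 2) ^ 3 * (4 * (3 * (X'.adjugate.trace * Y'.adjugate.trace) - X'.trace ^ 2 * Y'.adjugate.trace
          - Y'.trace ^ 2 * X'.adjugate.trace)
        + 4 * (X'.trace * Y'.trace) * ((X' + Y').adjugate.trace - X'.adjugate.trace - Y'.adjugate.trace)
        - 3 * ((X' + Y').adjugate.trace - X'.adjugate.trace - Y'.adjugate.trace) ^ 2) := by
    have b1' : ((1 : Matrix (Fin 3) (Fin 3) ℝ) + X').adjugate.trace = 2 * X'.trace + 3 + X'.adjugate.trace := by linarith
    have b2' : ((1 : Matrix (Fin 3) (Fin 3) ℝ) + Y').adjugate.trace = 2 * Y'.trace + 3 + Y'.adjugate.trace := by linarith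
    rw [b1', b2']
    ring
  rw [key]
  exact mul_nonneg (pow_nonneg hd 3) g


/-! ## Row G4 (the `4 × 4` Gram determinant) -/

set_option maxHeartbeats 2000000 in
set_option maxRecDepth 8000 in
/-- **G4 at `P = 1`, reduced form**: for symmetric `3 × 3` matrices `X, Y, Z`, with `q = tr ∘ adj`, `β(U,W) = q(U+W) − q U − q W` (`= 2 b_1`),
the determinant of `[[6, 2tr X, 2tr Y, 2tr Z], [2tr X, 2qX, β(X,Y), β(X,Z)], [2tr Y, β(X,Y), 2qY, β(Y,Z)], [2tr Z, β(X,Z), β(Y,Z), 2qZ]]`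
(`= 16 ×` the Gram determinant of `(1, X, Y, Z)` under `b_1`) is `≤ 0`: it equals `−6 · det Gram_F(X₀, Y₀, Z₀)` for the trace-free parts,
a Euclidean Gram determinant (`Matrix.posSemidef_self_mul_conjTranspose`, `PosSemidef.det_nonneg`).  (Large `ring` identity: raised
heartbeats.) [folklore] -/
theorem gram_four_nonpos_one {X Y Z : Matrix (Fin 3) (Fin 3) ℝ} (hX : X.IsSymm) (hY : Y.IsSymm) (hZ : Z.IsSymm) :
    6 * (2 * X.adjugate.trace) * (2 * Y.adjugate.trace) * (2 * Z.adjugate.trace) - 6 * (2 * X.adjugate.trace) * ((Y + Z).adjugate.trace - Y.adjugate.trace - Z.adjugate.trace) * ((Y + Z).adjugate.trace - Y.adjugate.trace - Z.adjugate.trace) - 6 * ((X + Y).adjugate.trace - X.adjugate.trace - Y.adjugate.trace) * ((X + Y).adjugate.trace - X.adjugate.trace - Y.adjugate.trace) * (2 * Z.adjugate.trace) + 6 * ((X + Y).adjugate.trace - X.adjugate.trace - Y.adjugate.trace) * ((Y + Z).adjugate.trace - Y.adjugate.trace - Z.adjugate.trace) * ((X + Z).adjugate.trace - X.adjugate.trace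 - Z.adjugate.trace) + 6 * ((X + Z).adjugate.trace - X.adjugate.trace - Z.adjugate.trace) * ((X + Y).adjugate.trace - X.adjugate.trace - Y.adjugate.trace) * ((Y + Z).adjugate.trace - Y.adjugate.trace - Z.adjugate.trace) - 6 * ((X + Z).adjugate.trace - X.adjugate.trace - Z.adjugate.trace) * (2 * Y.adjugate.trace) * ((X + Z).adjugate.trace - X.adjugate.trace - Z.adjugate.trace) - (2 * X.trace) * (2 * X.trace) * (2 * Y.adjugate.trace) * (2 * Z.adjugate.trace) + (2 * X.trace) * (2 * X.trace) * ((Y + Z).adjugate.trace - Y.adjugate.trace - Z.adjugate.trace) * ((Y + Z).adjugate.trace - Y.adjugate.trace - Z.adjugate.trace) + (2 * X.trace) * ((X + Y).adjugate.trace - X.adjugate.trace - Y.adjugate.trace) * (2 * Y.trace) * (2 * Z.adjugate.trace) - (2 * X.trace) * ((X + Y).adjugate.trace - X.adjugate.trace - Y.adjugate.trace) * ((Y + Z).adjugate.trace - Y.adjugate.trace - Z.adjugate.trace) * (2 * Z.trace) - (2 * X.trace) * ((X + Z).adjugate.trace - X.adjugate.trace - Z.adjugate.trace) * (2 * Y.trace)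 * ((Y + Z).adjugate.trace - Y.adjugate.trace - Z.adjugate.trace) + (2 * X.trace) * ((X + Z).adjugate.trace - X.adjugate.trace - Z.adjugate.trace) * (2 * Y.adjugate.trace) * (2 * Z.trace) + (2 * Y.trace) * (2 * X.trace) * ((X + Y).adjugate.trace - X.adjugate.trace - Y.adjugate.trace) * (2 * Z.adjugate.trace) - (2 * Y.trace) * (2 * X.trace) * ((Y + Z).adjugate.trace - Y.adjugate.trace - Z.adjugate.trace) * ((X + Z).adjugate.trace - X.adjugate.trace - Z.adjugate.trace) - (2 * Y.trace) * (2 * X.adjugate.trace) * (2 * Y.trace) * (2 * Z.adjugate.trace) + (2 * Y.trace) * (2 * X.adjugate.trace) * ((Y + Z).adjugate.trace - Y.adjugate.trace - Z.adjugate.trace) * (2 * Z.trace) + (2 * Y.trace) * ((X + Z).adjugate.trace - X.adjugate.trace - Z.adjugate.trace) * (2 * Y.trace) * ((X + Z).adjugate.trace - X.adjugate.trace - Z.adjugate.trace) - (2 * Y.trace) * ((X + Z).adjugate.trace - X.adjugate.trace - Z.adjugate.trace) * ((X + Y).adjugate.trace - X.adjugate.trace - Y.adjugate.trace) * (2 *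 Z.trace) - (2 * Z.trace) * (2 * X.trace) * ((X + Y).adjugate.trace - X.adjugate.trace - Y.adjugate.trace) * ((Y + Z).adjugate.trace - Y.adjugate.trace - Z.adjugate.trace) + (2 * Z.trace) * (2 * X.trace) * (2 * Y.adjugate.trace) * ((X + Z).adjugate.trace - X.adjugate.trace - Z.adjugate.trace) + (2 * Z.trace) * (2 * X.adjugate.trace) * (2 * Y.trace) * ((Y + Z).adjugate.trace - Y.adjugate.trace - Z.adjugate.trace) - (2 * Z.trace) * (2 * X.adjugate.trace) * (2 * Y.adjugate.trace) * (2 * Z.trace) - (2 * Z.trace) * ((X + Y).adjugate.trace - X.adjugate.trace - Y.adjugate.trace) * (2 * Y.trace) * ((X + Z).adjugate.trace - X.adjugate.trace - Z.adjugate.trace) + (2 * Z.trace) * ((X + Y).adjugate.trace - X.adjugate.trace - Y.adjugate.trace) * ((X + Y).adjugate.trace - X.adjugate.trace - Y.adjugate.trace) * (2 * Z.trace) ≤ 0 := by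
  set X₀ : Matrix (Fin 3) (Fin 3) ℝ := X - (X.trace / 3) • (1 : Matrix (Fin 3) (Fin 3) ℝ) with hX₀
  set Y₀ : Matrix (Fin 3) (Fin 3) ℝ := Y - (Y.trace / 3) • (1 : Matrix (Fin 3) (Fin 3) ℝ) with hY₀
  set Z₀ : Matrix (Fin 3) (Fin 3) ℝ := Z - (Z.trace / 3) • (1 : Matrix (Fin 3) (Fin 3) ℝ) with hZ₀
  set A : Matrix (Fin 3) (Fin 3 × Fin 3) ℝ :=
    Matrix.of fun r p => (![X₀, Y₀, Z₀] : Fin 3 → Matrix (Fin 3) (Fin 3) ℝ) r p.1 p.2 with hA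
  have hpsd : (A * Aᵀ).PosSemidef := by
    have h := Matrix.posSemidef_self_mul_conjTranspose A
    rwa [Matrix.conjTranspose_eq_transpose_of_trivial] at h
  have hdet : 0 ≤ (A * Aᵀ).det := hpsd.det_nonneg
  have h10 : X 1 0 = X 0 1 := by simpa using hX.apply 0 1
  have h20 : X 2 0 = X 0 2 := by simpa using hX.apply 0 2
  have h21 : X 2 1 = X 1 2 := by simpa using hX.apply 1 2
  have k10 : Y 1 0 = Y 0 1 := by simpa using hY.apply 0 1
  have k20 : Y 2 0 = Y 0 2 := by simpa using hY.apply 0 2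
  have k21 : Y 2 1 = Y 1 2 := by simpa using hY.apply 1 2
  have l10 : Z 1 0 = Z 0 1 := by simpa using hZ.apply 0 1
  have l20 : Z 2 0 = Z 0 2 := by simpa using hZ.apply 0 2
  have l21 : Z 2 1 = Z 1 2 := by simpa using hZ.apply 1 2
  have ident : 6 * (2 * X.adjugate.trace) * (2 * Y.adjugate.trace) * (2 * Z.adjugate.trace) - 6 * (2 * X.adjugate.trace) * ((Y + Z).adjugate.trace - Y.adjugate.trace - Z.adjugate.trace) * ((Y + Z).adjugate.trace - Y.adjugate.trace - Z.adjugate.trace) - 6 * ((X + Y).adjugate.trace - X.adjugate.trace - Y.adjugate.trace) * ((X + Y).adjugate.trace - X.adjugate.trace - Y.adjugate.trace) * (2 * Z.adjugate.trace) + 6 * ((X + Y).adjugate.trace - X.adjugate.trace - Y.adjugate.trace) * ((Y + Z).adjugate.trace - Y.adjugate.trace - Z.adjugate.trace) * ((X + Z).adjugate.trace - X.adjugate.trace - Z.adjugate.trace) + 6 * ((X + Z).adjugate.trace - X.adjugate.trace - Z.adjugate.trace) * ((X + Y).adjugate.trace - X.adjugate.trace - Y.adjugate.trace) * ((Y + Z).adjugate.trace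 - Y.adjugate.trace - Z.adjugate.trace) - 6 * ((X + Z).adjugate.trace - X.adjugate.trace - Z.adjugate.trace) * (2 * Y.adjugate.trace) * ((X + Z).adjugate.trace - X.adjugate.trace - Z.adjugate.trace) - (2 * X.trace) * (2 * X.trace) * (2 * Y.adjugate.trace) * (2 * Z.adjugate.trace) + (2 * X.trace) * (2 * X.trace) * ((Y + Z).adjugate.trace - Y.adjugate.trace - Z.adjugate.trace) * ((Y + Z).adjugate.trace - Y.adjugate.trace - Z.adjugate.trace) + (2 * X.trace) * ((X + Y).adjugate.trace - X.adjugate.trace - Y.adjugate.trace) * (2 * Y.trace) * (2 * Z.adjugate.trace) - (2 * X.trace) * ((X + Y).adjugate.trace - X.adjugate.trace - Y.adjugate.trace) * ((Y + Z).adjugate.trace - Y.adjugate.trace - Z.adjugate.trace) * (2 * Z.trace) - (2 * X.trace) * ((X + Z).adjugate.trace - X.adjugate.trace - Z.adjugate.trace) * (2 * Y.trace) * ((Y + Z).adjugate.trace - Y.adjugate.trace - Z.adjugate.trace) + (2 * X.trace) * ((X + Z).adjugate.trace - X.adjugate.trace - Z.adjugate.trace) * (2 * Y.adjugate.trace) *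 (2 * Z.trace) + (2 * Y.trace) * (2 * X.trace) * ((X + Y).adjugate.trace - X.adjugate.trace - Y.adjugate.trace) * (2 * Z.adjugate.trace) - (2 * Y.trace) * (2 * X.trace) * ((Y + Z).adjugate.trace - Y.adjugate.trace - Z.adjugate.trace) * ((X + Z).adjugate.trace - X.adjugate.trace - Z.adjugate.trace) - (2 * Y.trace) * (2 * X.adjugate.trace) * (2 * Y.trace) * (2 * Z.adjugate.trace) + (2 * Y.trace) * (2 * X.adjugate.trace) * ((Y + Z).adjugate.trace - Y.adjugate.trace - Z.adjugate.trace) * (2 * Z.trace) + (2 * Y.trace) * ((X + Z).adjugate.trace - X.adjugate.trace - Z.adjugate.trace) * (2 * Y.trace) * ((X + Z).adjugate.trace - X.adjugate.trace - Z.adjugate.trace) - (2 * Y.trace) * ((X + Z).adjugate.trace - X.adjugate.trace - Z.adjugate.trace) * ((X + Y).adjugate.trace - X.adjugate.trace - Y.adjugate.trace) * (2 * Z.trace) - (2 * Z.trace) * (2 * X.trace) * ((X + Y).adjugate.trace - X.adjugate.trace - Y.adjugate.trace) * ((Y + Z).adjugate.trace - Y.adjugate.trace - Z.adjugate.trace)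 + (2 * Z.trace) * (2 * X.trace) * (2 * Y.adjugate.trace) * ((X + Z).adjugate.trace - X.adjugate.trace - Z.adjugate.trace) + (2 * Z.trace) * (2 * X.adjugate.trace) * (2 * Y.trace) * ((Y + Z).adjugate.trace - Y.adjugate.trace - Z.adjugate.trace) - (2 * Z.trace) * (2 * X.adjugate.trace) * (2 * Y.adjugate.trace) * (2 * Z.trace) - (2 * Z.trace) * ((X + Y).adjugate.trace - X.adjugate.trace - Y.adjugate.trace) * (2 * Y.trace) * ((X + Z).adjugate.trace - X.adjugate.trace - Z.adjugate.trace) + (2 * Z.trace) * ((X + Y).adjugate.trace - X.adjugate.trace - Y.adjugate.trace) * ((X + Y).adjugate.trace - X.adjugate.trace - Y.adjugate.trace) * (2 * Z.trace)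
      = -6 * (A * Aᵀ).det := by
    -- left side: expand the adjugate traces and traces in entries
    rw [trace_adjugate_fin_three X, trace_adjugate_fin_three Y, trace_adjugate_fin_three Z,
      trace_adjugate_fin_three (X + Y), trace_adjugate_fin_three (X + Z), trace_adjugate_fin_three (Y + Z),
      Matrix.trace_fin_three, Matrix.trace_fin_three, Matrix.trace_fin_three]
    simp only [Matrix.add_apply, h10, h20, h21, k10, k20, k21, l10, l20, l21]
    -- right side: the Gram determinant in entries
    rw [Matrix.det_fin_three]
    simp only [hA, Matrix.mul_apply, Fintype.sum_prod_type, Fin.sum_univ_three, Matrix.transpose_apply, Matrix.of_apply,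
      Matrix.cons_val_zero, Matrix.cons_val_one, Matrix.head_cons, Matrix.cons_val_two, Matrix.tail_cons,
      hX₀, hY₀, hZ₀, Matrix.sub_apply, Matrix.smul_apply, Matrix.one_apply_eq,
      Matrix.one_apply_ne (by decide : (0 : Fin 3) ≠ 1), Matrix.one_apply_ne (by decide : (0 : Fin 3) ≠ 2),
      Matrix.one_apply_ne (by decide : (1 : Fin 3) ≠ 0), Matrix.one_apply_ne (by decide : (1 : Fin 3) ≠ 2),
      Matrix.one_apply_ne (by decide : (2 : Fin 3) ≠ 0), Matrix.one_apply_ne (by decide : (2 : Fin 3) ≠ 1),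
      smul_eq_mul, mul_one, mul_zero, sub_zero, Matrix.trace_fin_three, h10, h20, h21, k10, k20, k21, l10, l20, l21]
    ring
  rw [ident]
  linarith [hdet]

set_option maxHeartbeats 2000000 in
/-- **ROW G4 — Gram sign for a positive definite letter** (`3 × 3`): for `P ≻ 0` and symmetric `X, Y, Z`, with `q(W) := tr(adj W · P)`
(`= 3 D(P,W,W)`) and `β(U,W) := q(U+W) − q U − q W` (`= 6 D(P,U,W)`), the determinant of the symmetric `4 × 4` matrix with diagonal
`2q(P), 2q(X), 2q(Y), 2q(Z)` and off-diagonal entries `β` — `16 ×` the Gram determinant of `(P, X, Y, Z)` under `b_P = β/2`, signature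
`≤ (1,3)` — is `≤ 0`.  Reduced to `P = 1` by `Census.trace_adjugate_congr` (each entry scales by `(det M)²`). [folklore] -/
theorem garding_row_G4 {P X Y Z : Matrix (Fin 3) (Fin 3) ℝ} (hP : P.PosDef) (hX : X.IsSymm) (hY : Y.IsSymm) (hZ : Z.IsSymm) :
    (2 * (P.adjugate * P).trace) * (2 * (X.adjugate * P).trace) * (2 * (Y.adjugate * P).trace) * (2 * (Z.adjugate * P).trace) - (2 * (P.adjugate * P).trace) * (2 * (X.adjugate * P).trace) * (((Y + Z).adjugate * P).trace - (Y.adjugate * P).trace - (Z.adjugate * P).trace) * (((Y + Z).adjugate * P).trace - (Y.adjugate * P).trace - (Z.adjugate * P).trace) - (2 * (P.adjugate * P).trace) * (((X + Y).adjugate * P).trace - (X.adjugate * P).trace - (Y.adjugate * P).trace) * (((X + Y).adjugate * P).trace - (X.adjugate * P).trace - (Y.adjugate * P).trace) * (2 * (Z.adjugate * P).trace) + (2 * (P.adjugate * P).trace) * (((X + Y).adjugate * P).trace - (X.adjugate * P).trace - (Y.adjugate * P).trace) * (((Y + Z).adjugate * P).trace - (Y.adjugate * P).trace - (Z.adjugate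 * P).trace) * (((X + Z).adjugate * P).trace - (X.adjugate * P).trace - (Z.adjugate * P).trace) + (2 * (P.adjugate * P).trace) * (((X + Z).adjugate * P).trace - (X.adjugate * P).trace - (Z.adjugate * P).trace) * (((X + Y).adjugate * P).trace - (X.adjugate * P).trace - (Y.adjugate * P).trace) * (((Y + Z).adjugate * P).trace - (Y.adjugate * P).trace - (Z.adjugate * P).trace) - (2 * (P.adjugate * P).trace) * (((X + Z).adjugate * P).trace - (X.adjugate * P).trace - (Z.adjugate * P).trace) * (2 * (Y.adjugate * P).trace) * (((X + Z).adjugate * P).trace - (X.adjugate * P).trace - (Z.adjugate * P).trace) - (((P + X).adjugate * P).trace - (P.adjugate * P).trace - (X.adjugate * P).trace) * (((P + X).adjugate * P).trace - (P.adjugate * P).trace - (X.adjugate * P).trace) * (2 * (Y.adjugate * P).trace) * (2 * (Z.adjugate * P).trace) + (((P + X).adjugate * P).trace - (P.adjugate * P).trace - (X.adjugate * P).trace) * (((P + X).adjugate * P).trace - (P.adjugate * P).trace - (X.adjugate * P).trace) * (((Y + Z).adjugate * P).trace - (Y.adjugate * P).trace - (Z.adjugate * P).trace) * (((Y + Z).adjugate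 * P).trace - (Y.adjugate * P).trace - (Z.adjugate * P).trace) + (((P + X).adjugate * P).trace - (P.adjugate * P).trace - (X.adjugate * P).trace) * (((X + Y).adjugate * P).trace - (X.adjugate * P).trace - (Y.adjugate * P).trace) * (((P + Y).adjugate * P).trace - (P.adjugate * P).trace - (Y.adjugate * P).trace) * (2 * (Z.adjugate * P).trace) - (((P + X).adjugate * P).trace - (P.adjugate * P).trace - (X.adjugate * P).trace) * (((X + Y).adjugate * P).trace - (X.adjugate * P).trace - (Y.adjugate * P).trace) * (((Y + Z).adjugate * P).trace - (Y.adjugate * P).trace - (Z.adjugate * P).trace) * (((P + Z).adjugate * P).trace - (P.adjugate * P).trace - (Z.adjugate * P).trace) - (((P + X).adjugate * P).trace - (P.adjugate * P).trace - (X.adjugate * P).trace) * (((X + Z).adjugate * P).trace - (X.adjugate * P).trace - (Z.adjugate * P).trace) * (((P + Y).adjugate * P).trace - (P.adjugate * P).trace - (Y.adjugate * P).trace) * (((Y + Z).adjugate * P).trace - (Y.adjugate * P).trace - (Z.adjugate * P).trace) + (((P + X).adjugate * P).trace - (P.adjugate * P).trace - (X.adjugate * P).trace) * (((X + Z).adjugate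 * P).trace - (X.adjugate * P).trace - (Z.adjugate * P).trace) * (2 * (Y.adjugate * P).trace) * (((P + Z).adjugate * P).trace - (P.adjugate * P).trace - (Z.adjugate * P).trace) + (((P + Y).adjugate * P).trace - (P.adjugate * P).trace - (Y.adjugate * P).trace) * (((P + X).adjugate * P).trace - (P.adjugate * P).trace - (X.adjugate * P).trace) * (((X + Y).adjugate * P).trace - (X.adjugate * P).trace - (Y.adjugate * P).trace) * (2 * (Z.adjugate * P).trace) - (((P + Y).adjugate * P).trace - (P.adjugate * P).trace - (Y.adjugate * P).trace) * (((P + X).adjugate * P).trace - (P.adjugate * P).trace - (X.adjugate * P).trace) * (((Y + Z).adjugate * P).trace - (Y.adjugate * P).trace - (Z.adjugate * P).trace) * (((X + Z).adjugate * P).trace - (X.adjugate * P).trace - (Z.adjugate * P).trace) - (((P + Y).adjugate * P).trace - (P.adjugate * P).trace - (Y.adjugate * P).trace) * (2 * (X.adjugate * P).trace) * (((P + Y).adjugate * P).trace - (P.adjugate * P).trace - (Y.adjugate * P).trace) * (2 * (Z.adjugate * P).trace) + (((P + Y).adjugate * P).trace - (P.adjugate * P).trace - (Y.adjugate * P).trace)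 * (2 * (X.adjugate * P).trace) * (((Y + Z).adjugate * P).trace - (Y.adjugate * P).trace - (Z.adjugate * P).trace) * (((P + Z).adjugate * P).trace - (P.adjugate * P).trace - (Z.adjugate * P).trace) + (((P + Y).adjugate * P).trace - (P.adjugate * P).trace - (Y.adjugate * P).trace) * (((X + Z).adjugate * P).trace - (X.adjugate * P).trace - (Z.adjugate * P).trace) * (((P + Y).adjugate * P).trace - (P.adjugate * P).trace - (Y.adjugate * P).trace) * (((X + Z).adjugate * P).trace - (X.adjugate * P).trace - (Z.adjugate * P).trace) - (((P + Y).adjugate * P).trace - (P.adjugate * P).trace - (Y.adjugate * P).trace) * (((X + Z).adjugate * P).trace - (X.adjugate * P).trace - (Z.adjugate * P).trace) * (((X + Y).adjugate * P).trace - (X.adjugate * P).trace - (Y.adjugate * P).trace) * (((P + Z).adjugate * P).trace - (P.adjugate * P).trace - (Z.adjugate * P).trace) - (((P + Z).adjugate * P).trace - (P.adjugate * P).trace - (Z.adjugate * P).trace) * (((P + X).adjugate * P).trace - (P.adjugate * P).trace - (X.adjugate * P).trace) * (((X + Y).adjugate * P).trace - (X.adjugate * P).trace - (Y.adjugate * P).trace)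 * (((Y + Z).adjugate * P).trace - (Y.adjugate * P).trace - (Z.adjugate * P).trace) + (((P + Z).adjugate * P).trace - (P.adjugate * P).trace - (Z.adjugate * P).trace) * (((P + X).adjugate * P).trace - (P.adjugate * P).trace - (X.adjugate * P).trace) * (2 * (Y.adjugate * P).trace) * (((X + Z).adjugate * P).trace - (X.adjugate * P).trace - (Z.adjugate * P).trace) + (((P + Z).adjugate * P).trace - (P.adjugate * P).trace - (Z.adjugate * P).trace) * (2 * (X.adjugate * P).trace) * (((P + Y).adjugate * P).trace - (P.adjugate * P).trace - (Y.adjugate * P).trace) * (((Y + Z).adjugate * P).trace - (Y.adjugate * P).trace - (Z.adjugate * P).trace) - (((P + Z).adjugate * P).trace - (P.adjugate * P).trace - (Z.adjugate * P).trace) * (2 * (X.adjugate * P).trace) * (2 * (Y.adjugate * P).trace) * (((P + Z).adjugate * P).trace - (P.adjugate * P).trace - (Z.adjugate * P).trace) - (((P + Z).adjugate * P).trace - (P.adjugate * P).trace - (Z.adjugate * P).trace) * (((X + Y).adjugate * P).trace - (X.adjugate * P).trace - (Y.adjugate * P).trace) * (((P + Y).adjugate * P).trace - (P.adjugate * P).trace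 - (Y.adjugate * P).trace) * (((X + Z).adjugate * P).trace - (X.adjugate * P).trace - (Z.adjugate * P).trace) + (((P + Z).adjugate * P).trace - (P.adjugate * P).trace - (Z.adjugate * P).trace) * (((X + Y).adjugate * P).trace - (X.adjugate * P).trace - (Y.adjugate * P).trace) * (((X + Y).adjugate * P).trace - (X.adjugate * P).trace - (Y.adjugate * P).trace) * (((P + Z).adjugate * P).trace - (P.adjugate * P).trace - (Z.adjugate * P).trace) ≤ 0 := by
  obtain ⟨M, hM, rfl⟩ := exists_mul_transpose_of_posDef hP
  have hMu : IsUnit M.det := isUnit_iff_ne_zero.2 hM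
  have hMT : IsUnit Mᵀ.det := by rw [det_transpose]; exact hMu
  have pull : ∀ W : Matrix (Fin 3) (Fin 3) ℝ, W.IsSymm →
      ∃ W' : Matrix (Fin 3) (Fin 3) ℝ, W'.IsSymm ∧ W = M * W' * Mᵀ := by
    intro W hW
    refine ⟨M⁻¹ * W * Mᵀ⁻¹, ?_, ?_⟩
    · unfold Matrix.IsSymm
      rw [transpose_mul, transpose_mul, ← transpose_nonsing_inv, transpose_transpose, hW.eq, transpose_nonsing_inv,
        Matrix.mul_assoc]
    · calc W = (M * M⁻¹) * W * (Mᵀ⁻¹ * Mᵀ) := by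
            rw [Matrix.mul_nonsing_inv M hMu, Matrix.nonsing_inv_mul Mᵀ hMT, Matrix.one_mul, Matrix.mul_one]
        _ = M * (M⁻¹ * W * Mᵀ⁻¹) * Mᵀ := by simp only [Matrix.mul_assoc]
  obtain ⟨X', hX', rfl⟩ := pull X hX
  obtain ⟨Y', hY', rfl⟩ := pull Y hY
  obtain ⟨Z', hZ', rfl⟩ := pull Z hZ
  have hsum : ∀ A B : Matrix (Fin 3) (Fin 3) ℝ, M * A * Mᵀ + M * B * Mᵀ = M * (A + B) * Mᵀ := by
    intro A B; rw [Matrix.mul_add, Matrix.add_mul]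
  have e1 : ((M * Mᵀ).adjugate * (M * Mᵀ)).trace = M.det ^ 2 * (1 : Matrix (Fin 3) (Fin 3) ℝ).adjugate.trace := by
    have h := trace_adjugate_congr M 1
    rwa [Matrix.mul_one] at h
  have eP : ∀ W' : Matrix (Fin 3) (Fin 3) ℝ,
      ((M * Mᵀ + M * W' * Mᵀ).adjugate * (M * Mᵀ)).trace = M.det ^ 2 * ((1 : Matrix (Fin 3) (Fin 3) ℝ) + W').adjugate.trace := by
    intro W'
    have h := trace_adjugate_congr M (1 + W')
    rwa [Matrix.mul_add, Matrix.add_mul, Matrix.mul_one] at h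
  rw [e1, eP, eP, eP, hsum, hsum, hsum, trace_adjugate_congr, trace_adjugate_congr, trace_adjugate_congr, trace_adjugate_congr,
    trace_adjugate_congr, trace_adjugate_congr, trace_adjugate_one_three]
  have b1 := polar_trace_adjugate_one X'
  have b2 := polar_trace_adjugate_one Y'
  have b3 := polar_trace_adjugate_one Z'
  rw [trace_adjugate_one_three] at b1 b2 b3
  have b1' : ((1 : Matrix (Fin 3) (Fin 3) ℝ) + X').adjugate.trace = 2 * X'.trace + 3 + X'.adjugate.trace := by linarith
  have b2' : ((1 : Matrix (Fin 3) (Fin 3) ℝ) + Y').adjugate.trace = 2 * Y'.trace + 3 + Y'.adjugate.trace := by linarith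
  have b3' : ((1 : Matrix (Fin 3) (Fin 3) ℝ) + Z').adjugate.trace = 2 * Z'.trace + 3 + Z'.adjugate.trace := by linarith
  rw [b1', b2', b3']
  have g := gram_four_nonpos_one hX' hY' hZ'
  have hd : 0 ≤ M.det ^ 2 := sq_nonneg _
  linarith [mul_nonpos_iff.2 (Or.inl ⟨pow_nonneg hd 4, g⟩)]

end Summit.ValiantsHypothesis.ValiantsHypothesis.Theorems.LacunarySymmetroidMatrixDescartes.Census
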